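import Mathlib
import HarnessLib
import Summits.ValiantsHypothesis.ValiantsHypothesis.Theorems.LacunarySymmetroidMatrixDescartesProductPlusOneSlowKneeCellRateFree

/-!
# LINE (A) `product_plus_one` (crux `MatrixDescartes`, stmt-ValiantsHypothesis-18050, V1) — W-CB: ★★ the RATE-SEPARATED CELL at EVERY threshold
# (per window: ≤ 2 roots of `W(∏ f_j)` for binomial companies whose knee rates lie below, and pole rates above, one threshold `ρ`)

`K = 3`, support `d 0 < d 1 < d 2`, rates `r₀₁ = d1 − d0`, `r₁₂ = d2 − d1`, `r₀₂ = d2 − d0`; a binomial row on a pair is a KNEE (one-signed, `W(f)/f² > 0`,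
`ψ₁ < 0`) or a POLE (one change, `ψ₁ > 0` off its root).  In the tower of ✓ `…CloudDefs` every binomial row of rate `r` obeys the exact law
`ψ₃ − r²·ψ₁ = 6ψ₁²` (✓ `pair01_rowPsi3_law`, ✓ `pair12_rowPsi3_law`, ✓ `pair02_rowPsi3_law`), hence for ANY threshold `λ ≥ 1`:
`ψ₃ − λ²ψ₁ = 6ψ₁² + (r² − λ²)ψ₁ > 0` as soon as (knee and `r ≤ λ`) or (pole and `r ≥ λ`).  Summing over the rows and running the θ-shell
✓ `no_three_zeros_of_theta_sq_law` (val-lit-p5 g16, #20a) with `n + 1 = max(ρ, 1)`: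

* ★★ `rateSeparated_wronskian_no_three_zeros` / `rateSeparated_wronskian_roots_le_two` — PER WINDOW `(u,v)`, `0 < u`, threshold `ρ : ℕ`: every row a
  knee binomial of rate `≤ ρ` (any pair) or a pole binomial of rate `≥ ρ` (any pair) whose root is not in `(u,v)` (`0 ≤ f(u)f(v)`) ⇒ `W(∏ f_j)` has at
  most TWO roots in `(u,v)`.  `ρ = d1 − d0` is the binomial part of ✓ `slowKneeCellRateFree_wronskian_roots_le_two` (#20b); `ρ = d2 − d0` is NEW: knees on
  ALL THREE pairs at once (any number, all rates) against poles on the fast pair `(d0,d2)`; `ρ = d2 − d1` is NEW.  This is the RATE-SEPARATED LAW of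
  val-lit-p8 g17's memo `NOTE-p8g17-18050-pure-2N-law.md` §2 («max knee rate ≤ R ≤ min pole rate ⇒ ≤ 2 per bounded window», there by the variance
  comparison) in kernel by the additive `(θ² − λ²)` certificate, for companies (integer multiplicities = repeated rows).
* §0 row laws at an arbitrary threshold `λ` (`knee01/pole01/knee12/pole12/knee02/pole02_rate_law`: `λ²ψ₁ < ψ₃`).
* The GLOBAL, window-free count for this menu (`Z₊(W(∏_j f_j)) ≤ 3·m + 2`, Euler twin `≤ 5·m + 3`) is the companion file
  `…GlobalCellsRateSeparated` (window-assembly shell of ✓/⧗ `…GlobalCells`).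

HONEST FRAMING: W-cells + bookkeeping on BINOMIAL companies under a rate-separation hypothesis; the located extremisers of the per-window law (FAST knees
between SLOW poles, B-SHARP2/3) violate the hypothesis and are NOT covered; `WronskianBudgetK3` (EB2-W), `OneChangeFloorK3`, `stub_classRowK3`,
`stub_eulerBoundK3`, `stub_polyLaw`, `MatrixDescartes` (18050), Conjecture B are NOT proved; `VP ≠ VNP` is NOT proved.  No definitions, no named facts,
no sorry; Mathlib + ✓ lane modules only.
-/

set_option linter.dupNamespace false

namespace Summit.ValiantsHypothesis.ValiantsHypothesis.Theorems.LacunarySymmetroidMatrixDescartes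

namespace ProductPlusOne

open Finset Set Polynomial
open scoped BigOperators Topology Polynomial

/-! ### §0 Row rate laws at an arbitrary threshold `λ` -/

section Row

variable (e₁ e₂ : ℕ) (A B C : ℝ)

/-- Knee on `(d0,d1)` (normal form `A − Bx^p`, `A·B < 0`): `λ²ψ₁ < ψ₃` for every `λ ≥ p = e₁ + 1` (`ψ₃ − p²ψ₁ = 6ψ₁²`, `ψ₁ < 0`). [this file's lemma] -/
theorem knee01_rate_law {x lam : ℝ} (hx : 0 < x) (hAB : A * B < 0) (hlam : ((e₁ : ℝ) + 1) ^ 2 ≤ lam ^ 2) :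
    lam ^ 2 * rowPsi1 e₁ e₂ A B 0 x < rowPsi3 e₁ e₂ A B 0 x := by
  have hψ := pair01_knee_rowPsi1_neg e₁ e₂ A B hx hAB
  have hlaw := pair01_rowPsi3_law e₁ e₂ A B x
  have hψne := hψ.ne
  have hsq : 0 < rowPsi1 e₁ e₂ A B 0 x ^ 2 := by positivity
  have hprod : 0 ≤ (lam ^ 2 - ((e₁ : ℝ) + 1) ^ 2) * (-rowPsi1 e₁ e₂ A B 0 x) := mul_nonneg (by linarith) (by linarith)
  nlinarith [hprod, hsq, hlaw]

/-- Pole on `(d0,d1)` (`A·B > 0`, off its root): `λ²ψ₁ < ψ₃` for every `0 ≤ λ ≤ p`. [this file's lemma] -/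
theorem pole01_rate_law {x lam : ℝ} (hx : 0 < x) (hAB : 0 < A * B) (hF : A - B * x ^ (e₁ + 1) ≠ 0)
    (hlam : lam ^ 2 ≤ ((e₁ : ℝ) + 1) ^ 2) :
    lam ^ 2 * rowPsi1 e₁ e₂ A B 0 x < rowPsi3 e₁ e₂ A B 0 x := by
  have hψ := pair01_pole_rowPsi1_pos e₁ e₂ A B hx hAB hF
  have hlaw := pair01_rowPsi3_law e₁ e₂ A B x
  have hψne := hψ.ne'
  have hsq : 0 < rowPsi1 e₁ e₂ A B 0 x ^ 2 := by positivity
  have hprod : 0 ≤ (((e₁ : ℝ) + 1) ^ 2 - lam ^ 2) * rowPsi1 e₁ e₂ A B 0 x := mul_nonneg (by linarith) hψ.le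
  nlinarith [hprod, hsq, hlaw]

/-- Knee on `(d1,d2)` (normal form `−Bx^p − Cx^q`, `B·C > 0`): `λ²ψ₁ < ψ₃` for every `λ ≥ q − p = e₂ + 1`. [this file's lemma] -/
theorem knee12_rate_law {x lam : ℝ} (hx : 0 < x) (hBC : 0 < B * C) (hF : (0 : ℝ) - B * x ^ (e₁ + 1) - C * x ^ (e₁ + e₂ + 2) ≠ 0)
    (hlam : ((e₂ : ℝ) + 1) ^ 2 ≤ lam ^ 2) :
    lam ^ 2 * rowPsi1 e₁ e₂ 0 B C x < rowPsi3 e₁ e₂ 0 B C x := by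
  have hψ := pair12_knee_rowPsi1_neg e₁ e₂ B C hx hBC
  have hlaw := pair12_rowPsi3_law e₁ e₂ B C hF
  have hψne := hψ.ne
  have hsq : 0 < rowPsi1 e₁ e₂ 0 B C x ^ 2 := by positivity
  have hprod : 0 ≤ (lam ^ 2 - ((e₂ : ℝ) + 1) ^ 2) * (-rowPsi1 e₁ e₂ 0 B C x) := mul_nonneg (by linarith) (by linarith)
  nlinarith [hprod, hsq, hlaw]

/-- Pole on `(d1,d2)` (`B·C < 0`, off its root): `λ²ψ₁ < ψ₃` for every `0 ≤ λ ≤ q − p`. [this file's lemma] -/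
theorem pole12_rate_law {x lam : ℝ} (hx : 0 < x) (hBC : B * C < 0) (hF : (0 : ℝ) - B * x ^ (e₁ + 1) - C * x ^ (e₁ + e₂ + 2) ≠ 0)
    (hlam : lam ^ 2 ≤ ((e₂ : ℝ) + 1) ^ 2) :
    lam ^ 2 * rowPsi1 e₁ e₂ 0 B C x < rowPsi3 e₁ e₂ 0 B C x := by
  have hψ := pair12_pole_rowPsi1_pos e₁ e₂ B C hx hBC hF
  have hlaw := pair12_rowPsi3_law e₁ e₂ B C hF
  have hψne := hψ.ne'
  have hsq : 0 < rowPsi1 e₁ e₂ 0 B C x ^ 2 := by positivity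
  have hprod : 0 ≤ (((e₂ : ℝ) + 1) ^ 2 - lam ^ 2) * rowPsi1 e₁ e₂ 0 B C x := mul_nonneg (by linarith) hψ.le
  nlinarith [hprod, hsq, hlaw]

/-- Knee on `(d0,d2)` (normal form `A − Cx^q`, `A·C < 0`): `λ²ψ₁ < ψ₃` for every `λ ≥ q = e₁ + e₂ + 2`. [this file's lemma] -/
theorem knee02_rate_law {x lam : ℝ} (hx : 0 < x) (hAC : A * C < 0) (hlam : ((e₁ : ℝ) + e₂ + 2) ^ 2 ≤ lam ^ 2) :
    lam ^ 2 * rowPsi1 e₁ e₂ A 0 C x < rowPsi3 e₁ e₂ A 0 C x := by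
  have hψ := knee_rowPsi1_neg e₁ e₂ A C hx hAC
  have hlaw := pair02_rowPsi3_law e₁ e₂ A C x
  have hψne := hψ.ne
  have hsq : 0 < rowPsi1 e₁ e₂ A 0 C x ^ 2 := by positivity
  have hprod : 0 ≤ (lam ^ 2 - ((e₁ : ℝ) + e₂ + 2) ^ 2) * (-rowPsi1 e₁ e₂ A 0 C x) := mul_nonneg (by linarith) (by linarith)
  nlinarith [hprod, hsq, hlaw]

/-- Pole on `(d0,d2)` (`A·C > 0`, off its root): `λ²ψ₁ < ψ₃` for every `0 ≤ λ ≤ q`. [this file's lemma] -/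
theorem pole02_rate_law {x lam : ℝ} (hx : 0 < x) (hAC : 0 < A * C) (hF : A - C * x ^ (e₁ + e₂ + 2) ≠ 0)
    (hlam : lam ^ 2 ≤ ((e₁ : ℝ) + e₂ + 2) ^ 2) :
    lam ^ 2 * rowPsi1 e₁ e₂ A 0 C x < rowPsi3 e₁ e₂ A 0 C x := by
  have hψ := pair02_pole_rowPsi1_pos e₁ e₂ A C hx hAC hF
  have hlaw := pair02_rowPsi3_law e₁ e₂ A C x
  have hψne := hψ.ne'
  have hsq : 0 < rowPsi1 e₁ e₂ A 0 C x ^ 2 := by positivity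
  have hprod : 0 ≤ (((e₁ : ℝ) + e₂ + 2) ^ 2 - lam ^ 2) * rowPsi1 e₁ e₂ A 0 C x := mul_nonneg (by linarith) hψ.le
  nlinarith [hprod, hsq, hlaw]

end Row

/-! ### §1 The rate-separated cell, three-point form -/

/-- ★★ **THE RATE-SEPARATED CELL, three-point form.**  `K = 3`, `d 0 < d 1 < d 2`, `0 < m`, threshold `ρ : ℕ`, window `(u, v)` with `0 < u`; every
row `f_j = Σ_l C (a j l) X^{d l}` is a binomial of the menu
(K01) knee on `(d0,d1)` with `d1 − d0 ≤ ρ` · (P01) pole on `(d0,d1)` with `ρ ≤ d1 − d0` and `0 ≤ f_j(u)f_j(v)` · (K12) knee on `(d1,d2)` with `d2 − d1 ≤ ρ` ·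
(P12) pole on `(d1,d2)` with `ρ ≤ d2 − d1`, `0 ≤ f_j(u)f_j(v)` · (K02) knee on `(d0,d2)` with `d2 − d0 ≤ ρ` · (P02) pole on `(d0,d2)` with `ρ ≤ d2 − d0`,
`0 ≤ f_j(u)f_j(v)`.  Then `W(∏_j f_j)` does not vanish at three points `x₁ < x₂ < x₃` of `(u, v)`. [this file's theorem] -/
theorem rateSeparated_wronskian_no_three_zeros {m : ℕ} (hm : 0 < m) (d : Fin 3 → ℕ) (h01 : d 0 < d 1) (h12 : d 1 < d 2) (ρ : ℕ)
    (a : Fin m → Fin 3 → ℝ) {u v : ℝ} (hu : 0 < u)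
    (hrow : ∀ j,
      (a j 2 = 0 ∧ 0 < a j 0 * a j 1 ∧ d 1 - d 0 ≤ ρ) ∨
      (a j 2 = 0 ∧ a j 0 * a j 1 < 0 ∧ ρ ≤ d 1 - d 0 ∧
          0 ≤ (∑ l, C (a j l) * X ^ (d l) : ℝ[X]).eval u * (∑ l, C (a j l) * X ^ (d l) : ℝ[X]).eval v) ∨
      (a j 0 = 0 ∧ 0 < a j 1 * a j 2 ∧ d 2 - d 1 ≤ ρ) ∨
      (a j 0 = 0 ∧ a j 1 * a j 2 < 0 ∧ ρ ≤ d 2 - d 1 ∧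
          0 ≤ (∑ l, C (a j l) * X ^ (d l) : ℝ[X]).eval u * (∑ l, C (a j l) * X ^ (d l) : ℝ[X]).eval v) ∨
      (a j 1 = 0 ∧ 0 < a j 0 * a j 2 ∧ d 2 - d 0 ≤ ρ) ∨
      (a j 1 = 0 ∧ a j 0 * a j 2 < 0 ∧ ρ ≤ d 2 - d 0 ∧
          0 ≤ (∑ l, C (a j l) * X ^ (d l) : ℝ[X]).eval u * (∑ l, C (a j l) * X ^ (d l) : ℝ[X]).eval v))
    {x₁ x₂ x₃ : ℝ} (h₁ : x₁ ∈ Ioo u v) (h₃ : x₃ ∈ Ioo u v) (h12' : x₁ < x₂) (h23 : x₂ < x₃)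
    (hzero : ∀ x ∈ ({x₁, x₂, x₃} : Set ℝ),
      ((∏ j, ∑ l, C (a j l) * X ^ (d l) : ℝ[X]) * (X * derivative (X * derivative (∏ j, ∑ l, C (a j l) * X ^ (d l) : ℝ[X])))
        - (X * derivative (∏ j, ∑ l, C (a j l) * X ^ (d l) : ℝ[X])) ^ 2).eval x = 0) : False := by
  classical
  obtain ⟨e₁, he₁⟩ := Nat.exists_eq_add_of_lt h01
  obtain ⟨e₂, he₂⟩ := Nat.exists_eq_add_of_lt h12
  have hd := fin3_support_eq_gaps d e₁ e₂ he₁ he₂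
  have hr01 : d 1 - d 0 = e₁ + 1 := by omega
  have hr12 : d 2 - d 1 = e₂ + 1 := by omega
  have hr02 : d 2 - d 0 = e₁ + e₂ + 2 := by omega
  -- the shell's rate `n + 1 = max(ρ, 1)`
  obtain ⟨n, hn⟩ : ∃ n : ℕ, n = ρ - 1 := ⟨_, rfl⟩
  have hlam_knee : ∀ R : ℕ, R ≤ ρ → ((R : ℝ)) ^ 2 ≤ ((n : ℝ) + 1) ^ 2 := by
    intro R hR
    have h : R ≤ n + 1 := by omega
    have h' : (R : ℝ) ≤ (n : ℝ) + 1 := by exact_mod_cast h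
    exact pow_le_pow_left₀ R.cast_nonneg h' 2
  have hlam_pole : ∀ R : ℕ, 1 ≤ R → ρ ≤ R → ((n : ℝ) + 1) ^ 2 ≤ ((R : ℝ)) ^ 2 := by
    intro R h1 hR
    have h : n + 1 ≤ R := by omega
    have h' : (n : ℝ) + 1 ≤ (R : ℝ) := by exact_mod_cast h
    exact pow_le_pow_left₀ (by positivity) h' 2
  have hev : ∀ j x, (∑ l, C (a j l) * X ^ (d l) : ℝ[X]).eval x
      = x ^ (d 0) * (a j 0 + a j 1 * x ^ (e₁ + 1) + a j 2 * x ^ (e₁ + e₂ + 2)) := by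
    intro j x
    have h := (eval_trinomial_three (d 0) (e₁ + 1) (e₁ + e₂ + 2) (a j) x).1
    rw [hd] at h; rw [h]; ring
  have huv : u < v := h₁.1.trans h₁.2
  have hv : 0 < v := hu.trans huv
  have hIoo : ∀ x ∈ ({x₁, x₂, x₃} : Set ℝ), x ∈ Ioo u v := by
    intro x hx
    simp only [Set.mem_insert_iff, Set.mem_singleton_iff] at hx
    have h₂ : x₂ ∈ Ioo u v := ⟨h₁.1.trans h12', h23.trans h₃.2⟩
    rcases hx with h | h | h <;> subst h <;> assumption
  -- the endpoint product of `f_j` controls the stripped row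
  have hstrip : ∀ j, 0 ≤ (∑ l, C (a j l) * X ^ (d l) : ℝ[X]).eval u * (∑ l, C (a j l) * X ^ (d l) : ℝ[X]).eval v →
      0 ≤ (a j 0 + a j 1 * u ^ (e₁ + 1) + a j 2 * u ^ (e₁ + e₂ + 2)) * (a j 0 + a j 1 * v ^ (e₁ + 1) + a j 2 * v ^ (e₁ + e₂ + 2)) := by
    intro j h
    rw [hev, hev] at h
    have hpow : 0 < u ^ (d 0) * v ^ (d 0) := mul_pos (pow_pos hu _) (pow_pos hv _)
    have : u ^ (d 0) * (a j 0 + a j 1 * u ^ (e₁ + 1) + a j 2 * u ^ (e₁ + e₂ + 2))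
        * (v ^ (d 0) * (a j 0 + a j 1 * v ^ (e₁ + 1) + a j 2 * v ^ (e₁ + e₂ + 2)))
        = (u ^ (d 0) * v ^ (d 0)) * ((a j 0 + a j 1 * u ^ (e₁ + 1) + a j 2 * u ^ (e₁ + e₂ + 2))
          * (a j 0 + a j 1 * v ^ (e₁ + 1) + a j 2 * v ^ (e₁ + e₂ + 2))) := by ring
    rw [this] at h
    exact (mul_nonneg_iff_of_pos_left hpow).1 h
  -- KEY FACTS per row on the window: the normal form does not vanish, and the STRICT law `(n+1)²ψ₁ < ψ₃`
  have hkey : ∀ j, ∀ x ∈ Ioo u v,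
      a j 0 - (-(a j 1)) * x ^ (e₁ + 1) - (-(a j 2)) * x ^ (e₁ + e₂ + 2) ≠ 0 ∧
      ((n : ℝ) + 1) ^ 2 * rowPsi1 e₁ e₂ (a j 0) (-(a j 1)) (-(a j 2)) x
        < rowPsi3 e₁ e₂ (a j 0) (-(a j 1)) (-(a j 2)) x := by
    intro j x hx
    have hx0 : 0 < x := hu.trans hx.1
    rcases hrow j with ⟨h2, hs, hrate⟩ | ⟨h2, hs, hrate, hend⟩ | ⟨h0, hs, hrate⟩ | ⟨h0, hs, hrate, hend⟩ |
        ⟨h1, hs, hrate⟩ | ⟨h1, hs, hrate, hend⟩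
    · -- (K01) knee on (d0,d1), rate e₁+1 ≤ ρ
      have hn2 : -(a j 2) = 0 := by rw [h2, neg_zero]
      have hAB : a j 0 * (-(a j 1)) < 0 := by nlinarith
      have hF : a j 0 - (-(a j 1)) * x ^ (e₁ + 1) ≠ 0 := by
        intro h
        have hA : a j 0 = -(a j 1) * x ^ (e₁ + 1) := by linarith
        rw [hA] at hAB
        nlinarith [sq_nonneg (a j 1), pow_pos hx0 (e₁ + 1)]
      rw [hn2]
      refine ⟨by rwa [zero_mul, sub_zero], ?_⟩
      have hR := hlam_knee (e₁ + 1) (by rw [← hr01]; exact hrate)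
      push_cast at hR
      exact knee01_rate_law e₁ e₂ (a j 0) (-(a j 1)) hx0 hAB hR
    · -- (P01) pole on (d0,d1), rate e₁+1 ≥ ρ
      have hn2 : -(a j 2) = 0 := by rw [h2, neg_zero]
      have hg := hstrip j hend
      rw [h2] at hg
      simp only [zero_mul, add_zero] at hg
      have ha1 : a j 1 ≠ 0 := by rintro h; rw [h, mul_zero] at hs; exact lt_irrefl _ hs
      have hne : a j 0 + a j 1 * x ^ (e₁ + 1) ≠ 0 :=
        binomial_ne_zero_of_endpoints (a j 0) (a j 1) (Nat.succ_ne_zero e₁) hu hx hg ha1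
      have hF : a j 0 - (-(a j 1)) * x ^ (e₁ + 1) ≠ 0 := by
        have : a j 0 - (-(a j 1)) * x ^ (e₁ + 1) = a j 0 + a j 1 * x ^ (e₁ + 1) := by ring
        rwa [this]
      rw [hn2]
      refine ⟨by rwa [zero_mul, sub_zero], ?_⟩
      have hR := hlam_pole (e₁ + 1) (by omega) (by rw [← hr01]; exact hrate)
      push_cast at hR
      exact pole01_rate_law e₁ e₂ (a j 0) (-(a j 1)) hx0 (by nlinarith) hF hR
    · -- (K12) knee on (d1,d2), rate e₂+1 ≤ ρ
      have hBC : 0 < (-(a j 1)) * (-(a j 2)) := by nlinarith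
      have hsame : a j 1 + a j 2 * x ^ (e₂ + 1) ≠ 0 := by
        intro h
        have : a j 1 * (a j 1 + a j 2 * x ^ (e₂ + 1)) = 0 := by rw [h, mul_zero]
        nlinarith [mul_self_nonneg (a j 1), mul_pos hs (pow_pos hx0 (e₂ + 1))]
      have hF : (0 : ℝ) - (-(a j 1)) * x ^ (e₁ + 1) - (-(a j 2)) * x ^ (e₁ + e₂ + 2) ≠ 0 := by
        have : (0 : ℝ) - (-(a j 1)) * x ^ (e₁ + 1) - (-(a j 2)) * x ^ (e₁ + e₂ + 2)
            = x ^ (e₁ + 1) * (a j 1 + a j 2 * x ^ (e₂ + 1)) := by ring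
        rw [this]; exact mul_ne_zero (pow_ne_zero _ hx0.ne') hsame
      rw [h0]
      refine ⟨hF, ?_⟩
      have hR := hlam_knee (e₂ + 1) (by rw [← hr12]; exact hrate)
      push_cast at hR
      exact knee12_rate_law e₁ e₂ (-(a j 1)) (-(a j 2)) hx0 hBC hF hR
    · -- (P12) pole on (d1,d2), rate e₂+1 ≥ ρ
      have hg := hstrip j hend
      rw [h0] at hg
      simp only [zero_add] at hg
      have ha2 : a j 2 ≠ 0 := by rintro h; rw [h, mul_zero] at hs; exact lt_irrefl _ hs
      have hg' : 0 ≤ (a j 1 + a j 2 * u ^ (e₂ + 1)) * (a j 1 + a j 2 * v ^ (e₂ + 1)) := by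
        have hfac : (a j 1 * u ^ (e₁ + 1) + a j 2 * u ^ (e₁ + e₂ + 2)) * (a j 1 * v ^ (e₁ + 1) + a j 2 * v ^ (e₁ + e₂ + 2))
            = (u ^ (e₁ + 1) * v ^ (e₁ + 1)) * ((a j 1 + a j 2 * u ^ (e₂ + 1)) * (a j 1 + a j 2 * v ^ (e₂ + 1))) := by ring
        rw [hfac] at hg
        exact (mul_nonneg_iff_of_pos_left (mul_pos (pow_pos hu _) (pow_pos hv _))).1 hg
      have hne : a j 1 + a j 2 * x ^ (e₂ + 1) ≠ 0 :=
        binomial_ne_zero_of_endpoints (a j 1) (a j 2) (Nat.succ_ne_zero _) hu hx hg' ha2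
      have hF : (0 : ℝ) - (-(a j 1)) * x ^ (e₁ + 1) - (-(a j 2)) * x ^ (e₁ + e₂ + 2) ≠ 0 := by
        have : (0 : ℝ) - (-(a j 1)) * x ^ (e₁ + 1) - (-(a j 2)) * x ^ (e₁ + e₂ + 2)
            = x ^ (e₁ + 1) * (a j 1 + a j 2 * x ^ (e₂ + 1)) := by ring
        rw [this]; exact mul_ne_zero (pow_ne_zero _ hx0.ne') hne
      rw [h0]
      refine ⟨hF, ?_⟩
      have hR := hlam_pole (e₂ + 1) (by omega) (by rw [← hr12]; exact hrate)
      push_cast at hR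
      exact pole12_rate_law e₁ e₂ (-(a j 1)) (-(a j 2)) hx0 (by nlinarith) hF hR
    · -- (K02) knee on (d0,d2), rate e₁+e₂+2 ≤ ρ
      have hn1 : -(a j 1) = 0 := by rw [h1, neg_zero]
      have hAC : a j 0 * (-(a j 2)) < 0 := by nlinarith
      have hF : a j 0 - (-(a j 2)) * x ^ (e₁ + e₂ + 2) ≠ 0 := by
        intro h
        have hA : a j 0 = -(a j 2) * x ^ (e₁ + e₂ + 2) := by linarith
        rw [hA] at hAC
        nlinarith [sq_nonneg (a j 2), pow_pos hx0 (e₁ + e₂ + 2)]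
      rw [hn1]
      refine ⟨by rwa [zero_mul, sub_zero], ?_⟩
      have hR := hlam_knee (e₁ + e₂ + 2) (by rw [← hr02]; exact hrate)
      push_cast at hR
      have hR' : ((e₁ : ℝ) + e₂ + 2) ^ 2 ≤ ((n : ℝ) + 1) ^ 2 := by
        have : ((e₁ : ℝ) + e₂ + 2) = ((e₁ : ℝ) + (e₂ : ℝ) + 2) := rfl
        linarith [hR]
      exact knee02_rate_law e₁ e₂ (a j 0) (-(a j 2)) hx0 hAC hR'
    · -- (P02) pole on (d0,d2), rate e₁+e₂+2 ≥ ρ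
      have hn1 : -(a j 1) = 0 := by rw [h1, neg_zero]
      have hg := hstrip j hend
      rw [h1] at hg
      simp only [zero_mul, add_zero] at hg
      have ha2 : a j 2 ≠ 0 := by rintro h; rw [h, mul_zero] at hs; exact lt_irrefl _ hs
      have hne : a j 0 + a j 2 * x ^ (e₁ + e₂ + 2) ≠ 0 :=
        binomial_ne_zero_of_endpoints (a j 0) (a j 2) (Nat.succ_ne_zero _) hu hx hg ha2
      have hF : a j 0 - (-(a j 2)) * x ^ (e₁ + e₂ + 2) ≠ 0 := by
        have : a j 0 - (-(a j 2)) * x ^ (e₁ + e₂ + 2) = a j 0 + a j 2 * x ^ (e₁ + e₂ + 2) := by ring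
        rwa [this]
      rw [hn1]
      refine ⟨by rwa [zero_mul, sub_zero], ?_⟩
      have hR := hlam_pole (e₁ + e₂ + 2) (by omega) (by rw [← hr02]; exact hrate)
      push_cast at hR
      have hR' : ((n : ℝ) + 1) ^ 2 ≤ ((e₁ : ℝ) + e₂ + 2) ^ 2 := by linarith [hR]
      exact pole02_rate_law e₁ e₂ (a j 0) (-(a j 2)) hx0 (by nlinarith) hF hR'
  -- no row vanishes on the window
  have hf : ∀ x ∈ Ioo u v, ∀ j, (∑ l, C (a j l) * X ^ (d l) : ℝ[X]).eval x ≠ 0 := by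
    intro x hx j
    have hx0 : 0 < x := hu.trans hx.1
    rw [hev]
    have : a j 0 + a j 1 * x ^ (e₁ + 1) + a j 2 * x ^ (e₁ + e₂ + 2)
        = a j 0 - (-(a j 1)) * x ^ (e₁ + 1) - (-(a j 2)) * x ^ (e₁ + e₂ + 2) := by ring
    rw [this]
    exact mul_ne_zero (pow_ne_zero _ hx0.ne') (hkey j x hx).1
  -- at a root of `W(P)` in the window the slopes sum to zero
  have hsum : ∀ x ∈ ({x₁, x₂, x₃} : Set ℝ), ∑ j, rowPsi1 e₁ e₂ (a j 0) (-(a j 1)) (-(a j 2)) x = 0 := by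
    intro x hx
    have hxI := hIoo x hx
    have hx0 : 0 < x := hu.trans hxI.1
    have h := hzero x hx
    rw [logWronskian_prod_eq_rowPsi1_sum d e₁ e₂ he₁ he₂ a hx0 (hf x hxI)] at h
    have hP : ((∏ j, (∑ l, C (a j l) * X ^ (d l) : ℝ[X])).eval x) ≠ 0 := by
      rw [eval_prod]; exact Finset.prod_ne_zero_iff.2 fun j _ => hf x hxI j
    rcases mul_eq_zero.1 h with h1 | h1
    · exact absurd (neg_eq_zero.1 h1) (pow_ne_zero 2 hP)
    · exact h1
  -- the θ-shell with `S = Σψ₁`, `S₁ = Σψ₂`, `S₂ = Σψ₃` at rate `n + 1`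
  refine no_three_zeros_of_theta_sq_law n hu.le
    (S := fun x => ∑ j, rowPsi1 e₁ e₂ (a j 0) (-(a j 1)) (-(a j 2)) x)
    (S₁ := fun x => ∑ j, rowPsi2 e₁ e₂ (a j 0) (-(a j 1)) (-(a j 2)) x)
    (S₂ := fun x => ∑ j, rowPsi3 e₁ e₂ (a j 0) (-(a j 1)) (-(a j 2)) x)
    ?_ ?_ ?_ h₁ h₃ h12' h23 (hsum x₁ (by simp)) (hsum x₂ (by simp)) (hsum x₃ (by simp))
  · intro x hx
    have hx0 : x ≠ 0 := (hu.trans hx.1).ne'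
    have h := HasDerivAt.fun_sum (u := Finset.univ)
      (fun j _ => hasDerivAt_rowPsi1 e₁ e₂ (a j 0) (-(a j 1)) (-(a j 2)) hx0 (hkey j x hx).1)
    simpa only [Finset.sum_div] using h
  · intro x hx
    have hx0 : x ≠ 0 := (hu.trans hx.1).ne'
    have h := HasDerivAt.fun_sum (u := Finset.univ)
      (fun j _ => hasDerivAt_rowPsi2 e₁ e₂ (a j 0) (-(a j 1)) (-(a j 2)) hx0 (hkey j x hx).1)
    simpa only [Finset.sum_div] using h
  · intro x hx
    rw [Finset.mul_sum]
    exact Finset.sum_lt_sum (fun j _ => (hkey j x hx).2.le) ⟨⟨0, hm⟩, Finset.mem_univ _, (hkey _ x hx).2⟩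

/-- ★★ **THE RATE-SEPARATED CELL**: under the menu of `rateSeparated_wronskian_no_three_zeros` (threshold `ρ`, any `m`), `W(∏_j f_j)` has AT MOST TWO
roots in `(u, v)`. [this file's theorem] -/
theorem rateSeparated_wronskian_roots_le_two {m : ℕ} (d : Fin 3 → ℕ) (h01 : d 0 < d 1) (h12 : d 1 < d 2) (ρ : ℕ)
    (a : Fin m → Fin 3 → ℝ) {u v : ℝ} (hu : 0 < u)
    (hrow : ∀ j,
      (a j 2 = 0 ∧ 0 < a j 0 * a j 1 ∧ d 1 - d 0 ≤ ρ) ∨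
      (a j 2 = 0 ∧ a j 0 * a j 1 < 0 ∧ ρ ≤ d 1 - d 0 ∧
          0 ≤ (∑ l, C (a j l) * X ^ (d l) : ℝ[X]).eval u * (∑ l, C (a j l) * X ^ (d l) : ℝ[X]).eval v) ∨
      (a j 0 = 0 ∧ 0 < a j 1 * a j 2 ∧ d 2 - d 1 ≤ ρ) ∨
      (a j 0 = 0 ∧ a j 1 * a j 2 < 0 ∧ ρ ≤ d 2 - d 1 ∧
          0 ≤ (∑ l, C (a j l) * X ^ (d l) : ℝ[X]).eval u * (∑ l, C (a j l) * X ^ (d l) : ℝ[X]).eval v) ∨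
      (a j 1 = 0 ∧ 0 < a j 0 * a j 2 ∧ d 2 - d 0 ≤ ρ) ∨
      (a j 1 = 0 ∧ a j 0 * a j 2 < 0 ∧ ρ ≤ d 2 - d 0 ∧
          0 ≤ (∑ l, C (a j l) * X ^ (d l) : ℝ[X]).eval u * (∑ l, C (a j l) * X ^ (d l) : ℝ[X]).eval v)) :
    (((∏ j, ∑ l, C (a j l) * X ^ (d l) : ℝ[X]) * (X * derivative (X * derivative (∏ j, ∑ l, C (a j l) * X ^ (d l) : ℝ[X])))
        - (X * derivative (∏ j, ∑ l, C (a j l) * X ^ (d l) : ℝ[X])) ^ 2).roots.toFinset.filter (fun t => u < t ∧ t < v)).card ≤ 2 := by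
  classical
  set W : ℝ[X] := (∏ j, ∑ l, C (a j l) * X ^ (d l) : ℝ[X]) * (X * derivative (X * derivative (∏ j, ∑ l, C (a j l) * X ^ (d l) : ℝ[X])))
      - (X * derivative (∏ j, ∑ l, C (a j l) * X ^ (d l) : ℝ[X])) ^ 2 with hWdef
  by_contra hgt
  push Not at hgt
  obtain ⟨y₁, hy₁, y₂, hy₂, y₃, hy₃, h12', h23⟩ := exists_three_lt_of_card (T := W.roots.toFinset.filter (fun t => u < t ∧ t < v)) hgt
  by_cases hW0 : W = 0
  · rw [hW0, roots_zero, Multiset.toFinset_zero, Finset.filter_empty] at hy₁; exact absurd hy₁ (Finset.notMem_empty _)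
  have hm : 0 < m := by
    rcases Nat.eq_zero_or_pos m with h0 | hpos
    · subst h0
      exact absurd (by rw [hWdef]; simp) hW0
    · exact hpos
  rw [mem_filter, Multiset.mem_toFinset, mem_roots hW0] at hy₁ hy₂ hy₃
  refine rateSeparated_wronskian_no_three_zeros hm d h01 h12 ρ a hu hrow (x₁ := y₁) (x₂ := y₂) (x₃ := y₃)
    hy₁.2 hy₃.2 h12' h23 ?_
  intro x hx
  simp only [Set.mem_insert_iff, Set.mem_singleton_iff] at hx
  rcases hx with h | h | h <;> subst h
  · exact hy₁.1
  · exact hy₂.1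
  · exact hy₃.1

end ProductPlusOne

end Summit.ValiantsHypothesis.ValiantsHypothesis.Theorems.LacunarySymmetroidMatrixDescartes
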